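import Summits.Ventures.WeilGRH.ReflectionPrelims
import HarnessLib

/-!
# GRH arm (rh-explicit, venture WeilGRH): pointwise algebra for the reflection inequality BEYOND the shift

On a window `[-a, a]` with `L ≤ a < 3L/2` the translation `x ↦ x − L` has THREE-point fibres
`{x, x − L, x − 2L}` (`x ∈ [2L − a, a]`), on which the prime power `2L` (`n = 4` when `L = log 2`) acts as
the third edge of a triangle. `ReflectionInequalityBeyond.lean` bounds the polar direction on these fibres
by an `LDL*` decomposition of the `3 × 3` fibre form
`Q(v) = B Σ|vᵢ|² + 2κ Re(ω v₁ v̄₂) + 2κ Re(ω v₂ v̄₃) + 2κ' Re(ω' v₁ v̄₃)`;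
this file holds the pointwise identities: the expansion of `B|v₁ + p v₂ + r v₃|² + d₂|v₂ + s v₃|² + d₃|v₃|²`,
the dual expansion of the linear functional `η₁v₁ + η₂v₂ + η₃v₃` in the new coordinates, the three-term
weighted AM–GM, and the norms of the dual vectors for real `η`. Pure algebra; no analysis.

## References

* folklore (`LDL*` / Cholesky bookkeeping for a `3 × 3` hermitian form).
-/

noncomputable section

open Complex
open scoped Real ComplexConjugate

namespace Summit.Ventures.WeilGRH

/-! ## The `LDL*` expansion of the triangle form -/

/-- Universal expansion: `B|v₁ + p v₂ + r v₃|² + d₂|v₂ + s v₃|² + d₃|v₃|²` in monomials of `v`. [folklore] -/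
theorem ldl_expand (B d₂ d₃ : ℝ) (p r s v₁ v₂ v₃ : ℂ) :
    B * ‖v₁ + p * v₂ + r * v₃‖ ^ 2 + d₂ * ‖v₂ + s * v₃‖ ^ 2 + d₃ * ‖v₃‖ ^ 2 =
      B * ‖v₁‖ ^ 2 + (B * ‖p‖ ^ 2 + d₂) * ‖v₂‖ ^ 2 + (B * ‖r‖ ^ 2 + d₂ * ‖s‖ ^ 2 + d₃) * ‖v₃‖ ^ 2 +
        2 * ((B : ℂ) * conj p * (v₁ * conj v₂)).re + 2 * ((B : ℂ) * conj r * (v₁ * conj v₃)).re +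
        2 * (((B : ℂ) * p * conj r + d₂ * conj s) * (v₂ * conj v₃)).re := by
  simp only [Complex.sq_norm, Complex.normSq_apply, Complex.add_re, Complex.add_im, Complex.mul_re,
    Complex.mul_im, Complex.conj_re, Complex.conj_im, Complex.ofReal_re, Complex.ofReal_im]
  ring

/-- **The triangle form in `LDL*` coordinates**: under the five coefficient identities
`B|p|² + d₂ = B`, `B|r|² + d₂|s|² + d₃ = B`, `B conj p = κω`, `B conj r = κ'ω'`, `B p conj r + d₂ conj s = κω`,
`B(|v₁|² + |v₂|² + |v₃|²) + 2κRe(ω v₁v̄₂) + 2κRe(ω v₂v̄₃) + 2κ'Re(ω' v₁v̄₃) = B|u₁|² + d₂|u₂|² + d₃|u₃|²`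
with `u₁ = v₁ + p v₂ + r v₃`, `u₂ = v₂ + s v₃`, `u₃ = v₃`. [folklore] -/
theorem triangle_form_ldl {B d₂ d₃ κ κ' : ℝ} {p r s ω ω' : ℂ}
    (hI : B * ‖p‖ ^ 2 + d₂ = B) (hII : B * ‖r‖ ^ 2 + d₂ * ‖s‖ ^ 2 + d₃ = B)
    (hIII : (B : ℂ) * conj p = κ * ω) (hIV : (B : ℂ) * conj r = κ' * ω')
    (hV : (B : ℂ) * p * conj r + d₂ * conj s = κ * ω) (v₁ v₂ v₃ : ℂ) :
    B * (‖v₁‖ ^ 2 + ‖v₂‖ ^ 2 + ‖v₃‖ ^ 2) + 2 * κ * (ω * (v₁ * conj v₂)).re +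
        2 * κ * (ω * (v₂ * conj v₃)).re + 2 * κ' * (ω' * (v₁ * conj v₃)).re =
      B * ‖v₁ + p * v₂ + r * v₃‖ ^ 2 + d₂ * ‖v₂ + s * v₃‖ ^ 2 + d₃ * ‖v₃‖ ^ 2 := by
  have e1 : ∀ z : ℂ, ((κ : ℂ) * ω * z).re = κ * (ω * z).re := fun z ↦ by
    rw [mul_assoc, Complex.re_ofReal_mul]
  have e2 : ∀ z : ℂ, ((κ' : ℂ) * ω' * z).re = κ' * (ω' * z).re := fun z ↦ by
    rw [mul_assoc, Complex.re_ofReal_mul]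
  rw [ldl_expand, hI, hII, hIII, hIV, hV, e1, e1, e2]
  ring

/-- **The linear functional in `LDL*` coordinates**:
`η₁v₁ + η₂v₂ + η₃v₃ = η₁u₁ + (η₂ − pη₁)u₂ + (η₃ − sη₂ + (ps − r)η₁)u₃`. [folklore] -/
theorem triangle_functional_ldl (p r s η₁ η₂ η₃ v₁ v₂ v₃ : ℂ) :
    v₁ * η₁ + v₂ * η₂ + v₃ * η₃ =
      (v₁ + p * v₂ + r * v₃) * η₁ + (v₂ + s * v₃) * (η₂ - p * η₁) +
        v₃ * (η₃ - s * η₂ + (p * s - r) * η₁) := by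
  ring

/-! ## Three-term weighted AM–GM -/

/-- `|u₁ζ₁ + u₂ζ₂ + u₃ζ₃| ≤ ½[(μ₁|u₁|² + |ζ₁|²/μ₁) + (μ₂|u₂|² + |ζ₂|²/μ₂) + (μ₃|u₃|² + |ζ₃|²/μ₃)]`
for positive weights `μᵢ`. [folklore] -/
theorem norm_three_term_le {μ₁ μ₂ μ₃ : ℝ} (h₁ : 0 < μ₁) (h₂ : 0 < μ₂) (h₃ : 0 < μ₃)
    (u₁ u₂ u₃ ζ₁ ζ₂ ζ₃ : ℂ) :
    ‖u₁ * ζ₁ + u₂ * ζ₂ + u₃ * ζ₃‖ ≤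
      ((μ₁ * ‖u₁‖ ^ 2 + ‖ζ₁‖ ^ 2 / μ₁) + (μ₂ * ‖u₂‖ ^ 2 + ‖ζ₂‖ ^ 2 / μ₂) +
        (μ₃ * ‖u₃‖ ^ 2 + ‖ζ₃‖ ^ 2 / μ₃)) / 2 := by
  have g1 := two_mul_le_weighted (u := ‖u₁‖) (v := ‖ζ₁‖) h₁
  have g2 := two_mul_le_weighted (u := ‖u₂‖) (v := ‖ζ₂‖) h₂
  have g3 := two_mul_le_weighted (u := ‖u₃‖) (v := ‖ζ₃‖) h₃
  have hn : ‖u₁ * ζ₁ + u₂ * ζ₂ + u₃ * ζ₃‖ ≤ ‖u₁‖ * ‖ζ₁‖ + ‖u₂‖ * ‖ζ₂‖ + ‖u₃‖ * ‖ζ₃‖ := by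
    calc ‖u₁ * ζ₁ + u₂ * ζ₂ + u₃ * ζ₃‖ ≤ ‖u₁ * ζ₁ + u₂ * ζ₂‖ + ‖u₃ * ζ₃‖ := norm_add_le _ _
      _ ≤ ‖u₁ * ζ₁‖ + ‖u₂ * ζ₂‖ + ‖u₃ * ζ₃‖ := by linarith [norm_add_le (u₁ * ζ₁) (u₂ * ζ₂)]
      _ = ‖u₁‖ * ‖ζ₁‖ + ‖u₂‖ * ‖ζ₂‖ + ‖u₃‖ * ‖ζ₃‖ := by rw [norm_mul, norm_mul, norm_mul]
  linarith

/-! ## Norms of the dual vectors for real `η` -/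

/-- `|η₂ − p η₁|² = η₂² − 2 Re(p) η₁η₂ + |p|² η₁²` for real `η₁, η₂`. [folklore] -/
theorem normSq_dual_two (p : ℂ) (η₁ η₂ : ℝ) :
    ‖(η₂ : ℂ) - p * η₁‖ ^ 2 = η₂ ^ 2 - 2 * p.re * (η₁ * η₂) + ‖p‖ ^ 2 * η₁ ^ 2 := by
  simp only [Complex.sq_norm, Complex.normSq_apply, Complex.sub_re, Complex.sub_im, Complex.mul_re,
    Complex.mul_im, Complex.ofReal_re, Complex.ofReal_im]
  ring

/-- `|η₃ − s η₂ + e η₁|² = η₃² + |s|²η₂² + |e|²η₁² − 2Re(s) η₂η₃ + 2Re(e) η₁η₃ − 2Re(s conj e) η₁η₂`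
for real `ηᵢ`. [folklore] -/
theorem normSq_dual_three (s e : ℂ) (η₁ η₂ η₃ : ℝ) :
    ‖(η₃ : ℂ) - s * η₂ + e * η₁‖ ^ 2 =
      η₃ ^ 2 + ‖s‖ ^ 2 * η₂ ^ 2 + ‖e‖ ^ 2 * η₁ ^ 2 - 2 * s.re * (η₂ * η₃) + 2 * e.re * (η₁ * η₃) -
        2 * (s * conj e).re * (η₁ * η₂) := by
  simp only [Complex.sq_norm, Complex.normSq_apply, Complex.sub_re, Complex.sub_im, Complex.add_re,
    Complex.add_im, Complex.mul_re, Complex.mul_im, Complex.ofReal_re, Complex.ofReal_im,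
    Complex.conj_re, Complex.conj_im]
  ring

/-! ## Two more elementary integrals -/

/-- `∫_u^v cosh²((x − c)/2) dx = [(sinh(x − c) + (x − c))/2]_u^v`. [folklore] -/
theorem integral_cosh_half_sub_sq (c u v : ℝ) :
    ∫ x in u..v, Real.cosh ((x - c) / 2) ^ 2 =
      (Real.sinh (v - c) + (v - c)) / 2 - (Real.sinh (u - c) + (u - c)) / 2 := by
  have e := intervalIntegral.integral_comp_sub_right (fun y ↦ Real.cosh (y / 2) ^ 2) c (a := u) (b := v)
  rw [e, integral_cosh_half_sq]

/-- `cosh((x − c₁)/2) cosh((x − c₂)/2) = cosh(y/2) cosh((L' − y)/2)` with `y = x − c₁`, `L' = c₂ − c₁`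
(`cosh` is even), whence `∫_u^v cosh((x−c₁)/2)cosh((x−c₂)/2) dx` in closed form. [folklore] -/
theorem integral_cosh_half_sub_mul (c₁ c₂ u v : ℝ) :
    ∫ x in u..v, Real.cosh ((x - c₁) / 2) * Real.cosh ((x - c₂) / 2) =
      ((v - c₁) * Real.cosh ((c₂ - c₁) / 2) + Real.sinh ((v - c₁) - (c₂ - c₁) / 2)) / 2 -
        ((u - c₁) * Real.cosh ((c₂ - c₁) / 2) + Real.sinh ((u - c₁) - (c₂ - c₁) / 2)) / 2 := by
  have e := intervalIntegral.integral_comp_sub_right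
    (fun y ↦ Real.cosh (y / 2) * Real.cosh (((c₂ - c₁) - y) / 2)) c₁ (a := u) (b := v)
  have hf : (fun x ↦ Real.cosh ((x - c₁) / 2) * Real.cosh ((x - c₂) / 2)) =
      fun x ↦ Real.cosh ((x - c₁) / 2) * Real.cosh (((c₂ - c₁) - (x - c₁)) / 2) := by
    funext x
    rw [show ((c₂ - c₁) - (x - c₁)) / 2 = -((x - c₂) / 2) by ring, Real.cosh_neg]
  rw [hf, e, integral_cosh_half_mul_cosh_half_sub]

end Summit.Ventures.WeilGRH
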